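import Literature.MathematicalPhysics.QuantumFieldTheory.Balaban1983to89.B9Eq387IMSAssemblySmallField
import Literature.MathematicalPhysics.QuantumFieldTheory.Balaban1983to89.B9Eq387IMSMassWindow

/-!
# `Balaban1983to89.B9Eq387IMSTierPSmallField` — T. Bałaban, *Propagators for lattice gauge theories in a background field*, Commun. Math. Phys. **99**
# (1985) 389–434 [Balaban1985BackgroundPropagators] p. 408 «Σ_□ h²_□ = 1», (3.87)–(3.89) p. 409, p. 414 l.1–3 («O(M⁻¹), or O(M⁻²) … on a proper scale»),
# (3.26) p. 395, (3.49) p. 399, Thm 3.11 p. 416: **TIER P AT THE LATTICE, `∃`-FIRST, MODULO (loc) — given the local constants `γ₀ > 0`, `γ₁ ≤ 1`, `a ≥ 0`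
# of the cube estimate, a transport bound `M_T` and a plaquette bound `δ`, there are `ε₀ > 0` and a partition-scale threshold `M₁` such that for every
# bond window `ε_U ≤ ε₀`, every volume, every background `U` (`‖U(b) − 1‖ ≤ ε_U`, plaquettes `≤ δ`, the small-field data of `Q(U)`), every partition
# scale `M₀ ≥ M₁` with the tree's cut-offs: (loc) on the cubes ⟹
# `γ₁(‖D_RA‖² + ‖D*_SA‖² + a‖Q(U)A‖²) + (γ₀∕2)‖A‖² ≤ ‖D_RA‖² + ‖D*_SA‖² + a‖Q(U)A‖² − ‖(D_UP(U))†A‖²`** — the row-L11 junction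
# `B9Eq387IMSAssemblySmallField.ims_assembly_strong_small_background` (rows L1–L9 inhabited) with its correction rows absorbed into `γ₀∕2` by
# `B9Eq387IMSMassWindow.exists_mass_window`; route R2′ STEP B8′ of the pub-balaban NE9 chain: the instance-ledger's Tier P statement with EXACTLY ONE
# displayed row, (loc) = row L10 (`t4/ROUTES-NE9.md` v13.30–v13.44)

statement-level skeleton of published theorems with citation tags; proofs where landed; nothing here is a claim about the Yang–Mills mass gap

CITATION HEADER (lean-in-tree rule).  Audit cell `pub-balaban`, sub-cell `t4`, BINDER row NE9; filed by NE9 formalisation-swarm LEAF PROVER 01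
(`b2b-balaban-t4-ne9-formalise-leaf-01`, gen 86), composing BY NAME its own `ims_assembly_strong_small_background` (gen 86; over gen 83's kernel 7 at the
lattice, gen 85's row L9 `∃ ε₀`-first, ne9-leaf-06's row-L8 letter) and `exists_mass_window` (gen 86, Mathlib-only).  Source READ in the held text
[Balaban1985BackgroundPropagators] (journal page = PDF page + 388): p. 408 *«Σ_{□∈𝒟} h²_□ = 1»*, p. 409 (3.87)–(3.89), p. 414 l.1–3 *«They are of the order
O(M⁻¹), or O(M⁻²), if considered on a proper scale»*, p. 416 Thm 3.11 *«for … gauge fields U in a small neighbourhood of the identity»*.  Print localises by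
parametrices and random walks and takes `M` «sufficiently large» (p. 414–415); the IMS assembly, the `ε₀`-window and the threshold `M₁` are the ROUTE's
devices (existence by continuity); NOTHING of [B9] is asserted.

WHAT IS PROVED (sorry-free; proof lane — no `def`; [folklore] composition BY NAME + one monotonicity step).
* **`ims_tierP_small_background`** — THE THEOREM displayed above (torus dimension `d + 1`; local letters `T₁ = D` with transports `R`, `T₂ = D*` with
  transports `S`, both of norm `≤ M_T`, at `c = η⁻¹`; `T₃ = √a·Q(U)`; `W = T†`, `T = D_U(1 − R(U))`).
HONEST SCOPE.  `ε₀, M₁` exist (rows L8∕L9 windows + the mass window, all by continuity at the origin) — NOT in closed form, NO number (the SIZE of `M₁`,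
`ε₀` is the route's open number KAPPA1∕`M₀`); (loc) = row L10 (cube-localised strong coercivity with constants `γ₀, γ₁, a` — S-P4 ∕ S-P6′ ∕ B7′-1, other
lineages) and `Q(U)`'s definitional small-field data stay DISPLAYED; `L ≥ 3`, `m_i ≥ 2`, `ηL = 1`, `c₁ = L^{d+1}c₀`, ONE averaging step.  NOT NE9 (cell
pub-balaban: NE9 NOT PRINTED ∕ NOT PROVED; «NE9 ⇐ the named binders»; row WALLED ON A MODEL (O-NE9-1; #5 UNRULED); spine PROVED 0∕9; rung (B)+1 on a finite T⁴ —
NOT infinite volume, NOT mass gap, NOT BetaPertH, NOT Clay; HONEST DEPENDENCY: continuum YM on T⁴ ⇐ BetaPertH ∧ nine spine estimates (0/9 proved); BetaPertH ⇐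
(D1) ∧ (D4) ∧ CAP+tail; G-an2-4 gates asym, D1 and NE2/3/4).  NEW file importing the two files named; nothing modified.  Net new unproved facts: 0.
-/

noncomputable section

set_option autoImplicit false

open scoped BigOperators InnerProductSpace ComplexConjugate

namespace Literature.MathematicalPhysics.QuantumFieldTheory.Balaban1983to89.B9Eq387IMSTierPSmallField

open B4Sect5Torus (TSite)
open B4Sect5Proof (latticeConst latticeConst_nonneg)
open B5TorusCover (Ctr)
open B5SmoothPartition (hS)
open B7Prop1Explicit (U1 Wcx boxVec)
open B9SectCLatticeCarrier (Bond bpos btgt)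
open B9Eq311L2Pairing (WL2)
open B9Eq319QprimeTorus (fineP)
open B11Eq103H1Complex (SiteL2K BondL2K covDerivL2K covDivL2K)
open B9Eq310HessianOperator (PlaqL2K covCurlL2K adTransportW)
open B9Eq310DeltaPrime (plaqHolU)
open B9Eq315QTorus (perSite perCfg cornerSite QtorusW)
open B9Eq326OperatorAssembly (RofU)
open B9Eq387IMSAssemblySmallField (ims_assembly_strong_small_background)
open B9Eq387IMSMassWindow (exists_mass_window)

variable {d : ℕ} (L : ℕ) [NeZero L] (hL : 1 ≤ L) (hL3 : 3 ≤ L)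
  {𝔸 : Type*} [NormedRing 𝔸] [NormedAlgebra ℂ 𝔸] [NormOneClass 𝔸] [CompleteSpace 𝔸]
  {W : Type*} [NormedAddCommGroup W] [InnerProductSpace ℂ W] [FiniteDimensional ℂ W] (φ : W ≃ₗ[ℂ] 𝔸) {Mφ Mφ' : ℝ}
  (hφ : ∀ w, ‖φ w‖ ≤ Mφ * ‖w‖) (hφ' : ∀ X, ‖φ.symm X‖ ≤ Mφ' * ‖X‖) (hMφ : 0 ≤ Mφ) (hMφ' : 0 ≤ Mφ')
  (c₀ : ℝ) [Fact (0 < c₀)] (η : ℝ) (hη : 0 < η) (c₁ : ℝ) [Fact (0 < c₁)] (hc : c₁ = (L : ℝ) ^ (d + 1) * c₀) (a' : ℝ) (ha' : 0 < a')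
  (hηL : η * L = 1)

include hL hL3 hφ hφ' hMφ hMφ' hη hc ha' hηL in
/-- **TIER P AT THE LATTICE, `∃ ε₀ M₁` FIRST, MODULO (loc).**  Fix the structure letters and the (loc)-side data `a ≥ 0`, `γ₁ ≤ 1`, `γ₀ > 0`, a transport
bound `M_T ≥ 0` and a plaquette bound `δ ≥ 0`.  Then there are `ε₀ > 0` and `M₁ ≥ 1` such that for every volume (`m_i ≥ 2`), bond window `0 ≤ ε_U ≤ ε₀`,
background `U` (`U(b) ∈ U1`, `‖U(b) − 1‖ ≤ ε_U`, mutually adjoint transports, `Q(U)`'s small-field data, `‖U(∂p) − 1‖ ≤ δ`), `T = D_U(1 − R(U))`, partition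
scale `M₀ ≥ M₁` (`L ≤ M₀`, `M₀ ∣ Lm_i`, `2M₀ ≤ Lm_i`) with the tree's cut-offs, transports `R, S` of norm `≤ M_T`: (loc) on every cube ⟹
`γ₁(‖D_RA‖² + ‖D*_SA‖² + ‖√a·Q(U)A‖²) + (γ₀∕2)‖A‖² ≤ (‖D_RA‖² + ‖D*_SA‖² + ‖√a·Q(U)A‖²) − ‖T†A‖²`.  PROOF: `ims_assembly_strong_small_background` gives the
inequality with the bracket `γ₀ − b_W − (1−γ₁)(b₁ + b₂ + a·b₃)` in place of `γ₀∕2`; `exists_mass_window` (letters instantiated) makes the bracket `≥ γ₀∕2` for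
`ε_U ≤ ε₀`, `M₀ ≥ M₁`; `ε₀ := min` of the two. [folklore] (composition)
[cite: Balaban1985BackgroundPropagators, p.408 «Σ h²_□ = 1», (3.87)–(3.89) p.409, p.414 «O(M⁻¹), or O(M⁻²)», (3.26) p.395, (3.49) p.399, Thm 3.11 p.416] -/
theorem ims_tierP_small_background {a γ₁ γ₀ MT δ : ℝ} (ha : 0 ≤ a) (hγ₁ : γ₁ ≤ 1) (hγ₀ : 0 < γ₀) (hMT : 0 ≤ MT) (hδ0 : 0 ≤ δ) :
    ∃ ε₀ : ℝ, 0 < ε₀ ∧ ∃ M₁ : ℕ, 1 ≤ M₁ ∧ ∀ (m : Fin (d + 1) → ℕ) [∀ i, NeZero (m i)] [∀ i, NeZero (fineP L m i)] (_hm : ∀ i, 2 ≤ m i)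
      (εU : ℝ) (_hεU : 0 ≤ εU) (_hεU₀ : εU ≤ ε₀)
      (U : Bond (d + 1) (fineP L m) → 𝔸ˣ) (_hU : ∀ b, U b ∈ U1 𝔸) (_hUε : ∀ b, ‖(U b : 𝔸) - 1‖ ≤ εU)
      (_hRS : ∀ (b : Bond (d + 1) (fineP L m)) (v u : W), ⟪adTransportW φ U b v, u⟫_ℂ = ⟪v, adTransportW φ (fun b => (U b)⁻¹) b u⟫_ℂ)
      {α : ℝ} (hα1 : α ≤ 1 / 64) (hU1 : ∀ (x : B7Prop1Explicit.Site (d + 1)) (κ' : Fin (d + 1)), perCfg (fineP L m) U x κ' ∈ U1 𝔸)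
      (hreg : ∀ (y : TSite (d + 1) m) (κ' : Fin (d + 1)) (r : Fin (d + 1) → Fin L),
        ‖((Wcx L (perCfg (fineP L m) U) (cornerSite L y) κ' (boxVec L r) : 𝔸ˣ) : 𝔸) - 1‖ ≤ α)
      (_hδ : ∀ p : B9SectCLatticeCarrier.Plaq (d + 1) (fineP L m), ‖(plaqHolU U p : 𝔸) - 1‖ ≤ δ)
      (T : SiteL2K ℂ (d + 1) (fineP L m) c₀ W →L[ℂ] BondL2K ℂ (d + 1) (fineP L m) c₀ W)
      (_hT : T = LinearMap.toContinuousLinearMap (covDerivL2K ℂ c₀ ((η : ℂ))⁻¹ (adTransportW φ U) ∘ₗ (LinearMap.id - RofU L m φ η U (c₀ := c₀))))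
      (M₀ : ℕ) (_hM₁ : M₁ ≤ M₀) (_hLM : L ≤ M₀) (_hdiv : ∀ i, M₀ ∣ fineP L m i) (_h2N : ∀ i, 2 * M₀ ≤ fineP L m i)
      (χS : Ctr (fineP L m) M₀ → SiteL2K ℂ (d + 1) (fineP L m) c₀ W →L[ℂ] SiteL2K ℂ (d + 1) (fineP L m) c₀ W)
      (χB : Ctr (fineP L m) M₀ → BondL2K ℂ (d + 1) (fineP L m) c₀ W →L[ℂ] BondL2K ℂ (d + 1) (fineP L m) c₀ W)
      (χP : Ctr (fineP L m) M₀ → PlaqL2K ℂ (d + 1) (fineP L m) c₀ W →L[ℂ] PlaqL2K ℂ (d + 1) (fineP L m) c₀ W)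
      (χC : Ctr (fineP L m) M₀ → BondL2K ℂ (d + 1) m c₁ W →L[ℂ] BondL2K ℂ (d + 1) m c₁ W)
      (_hχS : ∀ (z : Ctr (fineP L m) M₀) (f : SiteL2K ℂ (d + 1) (fineP L m) c₀ W) (x : TSite (d + 1) (fineP L m)),
        WL2.equiv ℂ (fun _ : TSite (d + 1) (fineP L m) => c₀) W (χS z f) x =
          (hS (fineP L m) M₀ z x : ℂ) • WL2.equiv ℂ (fun _ : TSite (d + 1) (fineP L m) => c₀) W f x)
      (_hχB : ∀ (z : Ctr (fineP L m) M₀) (g : BondL2K ℂ (d + 1) (fineP L m) c₀ W) (b : Bond (d + 1) (fineP L m)),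
        WL2.equiv ℂ (fun _ : Bond (d + 1) (fineP L m) => c₀) W (χB z g) b =
          (hS (fineP L m) M₀ z (bpos b) : ℂ) • WL2.equiv ℂ (fun _ : Bond (d + 1) (fineP L m) => c₀) W g b)
      (_hχP : ∀ (z : Ctr (fineP L m) M₀) (G : PlaqL2K ℂ (d + 1) (fineP L m) c₀ W) (p : B9SectCLatticeCarrier.Plaq (d + 1) (fineP L m)),
        WL2.equiv ℂ (fun _ : B9SectCLatticeCarrier.Plaq (d + 1) (fineP L m) => c₀) W (χP z G) p =
          (hS (fineP L m) M₀ z p.1 : ℂ) • WL2.equiv ℂ (fun _ : B9SectCLatticeCarrier.Plaq (d + 1) (fineP L m) => c₀) W G p)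
      (_hχC : ∀ (z : Ctr (fineP L m) M₀) (g : BondL2K ℂ (d + 1) m c₁ W) (c : Bond (d + 1) m),
        WL2.equiv ℂ (fun _ : Bond (d + 1) m => c₁) W (χC z g) c =
          (hS (fineP L m) M₀ z (perSite (fineP L m) (cornerSite L c.1)) : ℂ) • WL2.equiv ℂ (fun _ : Bond (d + 1) m => c₁) W g c)
      {R S : Bond (d + 1) (fineP L m) → W →ₗ[ℂ] W} (_hR : ∀ b v, ‖R b v‖ ≤ MT * ‖v‖) (_hS' : ∀ b v, ‖S b v‖ ≤ MT * ‖v‖)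
      (_hloc : ∀ (z : Ctr (fineP L m) M₀) (A : BondL2K ℂ (d + 1) (fineP L m) c₀ W),
        γ₁ * (‖covCurlL2K ℂ c₀ ((η : ℂ))⁻¹ R (χB z A)‖ ^ 2 + ‖covDivL2K ℂ c₀ ((η : ℂ))⁻¹ S (χB z A)‖ ^ 2 +
            ‖((Real.sqrt a : ℝ) : ℂ) • QtorusW L m hL φ U hα1 hU1 hreg (c₁ := c₁) (χB z A)‖ ^ 2) + γ₀ * ‖χB z A‖ ^ 2 ≤
          (‖covCurlL2K ℂ c₀ ((η : ℂ))⁻¹ R (χB z A)‖ ^ 2 + ‖covDivL2K ℂ c₀ ((η : ℂ))⁻¹ S (χB z A)‖ ^ 2 +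
            ‖((Real.sqrt a : ℝ) : ℂ) • QtorusW L m hL φ U hα1 hU1 hreg (c₁ := c₁) (χB z A)‖ ^ 2) - ‖ContinuousLinearMap.adjoint T (χB z A)‖ ^ 2)
      (A : BondL2K ℂ (d + 1) (fineP L m) c₀ W),
      γ₁ * (‖covCurlL2K ℂ c₀ ((η : ℂ))⁻¹ R A‖ ^ 2 + ‖covDivL2K ℂ c₀ ((η : ℂ))⁻¹ S A‖ ^ 2 +
            ‖((Real.sqrt a : ℝ) : ℂ) • QtorusW L m hL φ U hα1 hU1 hreg (c₁ := c₁) A‖ ^ 2) + γ₀ / 2 * ‖A‖ ^ 2 ≤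
        (‖covCurlL2K ℂ c₀ ((η : ℂ))⁻¹ R A‖ ^ 2 + ‖covDivL2K ℂ c₀ ((η : ℂ))⁻¹ S A‖ ^ 2 +
            ‖((Real.sqrt a : ℝ) : ℂ) • QtorusW L m hL φ U hα1 hU1 hreg (c₁ := c₁) A‖ ^ 2) - ‖ContinuousLinearMap.adjoint T A‖ ^ 2 := by
  have hc₀ : 0 < c₀ := Fact.out
  have hc₁ : 0 < c₁ := Fact.out
  -- the junction (rows L1–L9 inhabited), `∃ ε₀ κ k` first
  obtain ⟨ε₁, κ, k, hε₁, _hκ, _hk, H2⟩ :=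
    ims_assembly_strong_small_background (d := d) L hL hL3 φ hφ hφ' hMφ hMφ' c₀ η hη c₁ hc a' ha' hηL
  -- the mass window for these letters
  obtain ⟨ε₂, hε₂, M₁, hM₁, H4⟩ := exists_mass_window d L η MT a
    (2 * (Real.sqrt ((d + 1 : ℕ) : ℝ) * (‖((η : ℂ))⁻¹‖ * (Mφ * Mφ') ^ 3 *
      (((27 : ℝ) / 4) ^ (d + 1) * (4 / (L : ℝ) + 2 * (((((d + 1 : ℕ) : ℝ) - 1) * ((L : ℝ) - 1)) * δ)))) + Real.sqrt a' * 2))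
    (((2 * 7 ^ (d + 1) : ℕ) : ℝ)) k ((16 / κ ^ 2 + 2) * latticeConst (d + 1) (κ / 2)) (Real.sqrt (c₁ / (c₀ * (L : ℝ) ^ (d + 1))))
    (Mφ' * Mφ * Real.sqrt (2 * ((d + 1 : ℕ) : ℝ) * c₁ / c₀)) (c₁ / (c₀ * (L : ℝ) ^ (d + 1))) γ₁ hγ₀
  refine ⟨min ε₁ ε₂, lt_min hε₁ hε₂, M₁, hM₁, ?_⟩
  intro m _ _ hm εU hεU hεU₀ U hU hUε hRS α hα1 hU1 hreg hδ T hT M₀ hM₁M hLM hdiv h2N χS χB χP χC hχS hχB hχP hχC R S hR hS' hloc A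
  have hM : 1 ≤ M₀ := le_trans hM₁ hM₁M
  have h := H2 m hm εU hεU (hεU₀.trans (min_le_left _ _)) U hU hUε hRS hα1 hU1 hreg hδ0 hδ T hT M₀ hM hLM hdiv h2N χS χB χP χC
    hχS hχB hχP hχC hMT hR hS' ha hγ₁ hloc A
  have hw := H4 εU hεU (hεU₀.trans (min_le_right _ _)) M₀ hM₁M
  exact le_trans (add_le_add le_rfl (mul_le_mul_of_nonneg_right hw (sq_nonneg ‖A‖))) h

end Literature.MathematicalPhysics.QuantumFieldTheory.Balaban1983to89.B9Eq387IMSTierPSmallField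

end
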